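import Summits.QuantumFields.YangMills.Theorems.LuscherReductionOneSiteLevelsValleySchurWeighted

/-!
# VALLEY, step 3c: the two-shell weighted Schur assembly with ONE pigeonholed radius
# (support module for `stub_absUpperValleyMag` of crux `OneSiteLevels`, route `LuscherReduction`, item stmt-QuantumFields-20007;
# fleet lead prover ym-luscher-20007-p1 g2)

Abstract assembly of the VALLEY gain from per-shell supersolution bounds.  Fix `B > 0`, an inner radius `ρ₀` (the test function `f`
vanishes on `{ρ < ρ₀}`, `ρ(U) = ‖zmCoord 1 U‖`), a window `[T, 2T]` for the shell boundary and a slab width `w`.  Suppose that for EVERY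
boundary `t ∈ [T, 2T]` the weighted supersolution quantities

  `J_τ(U) = e^{(τ−½)BS(U)} ∫ E_B(U,V) e^{−(½+τ)BS(V)} dV`

satisfy `J_{τ(t)}(U) ≤ Λ` on the lower shell `ρ₀ ≤ ρ(U) < t` and `J_0(U) ≤ Λ` on the upper shell `ρ(U) ≥ t`.  Then (`qform_le_of_twoShell`)

  `⟨f, K_B f⟩ ≤ (Λ + linkCE B / J + 3 e^{6B − Bw²}) ‖f‖²`,   `J` = number of disjoint candidate slabs in the window.

Proof: choose the boundary `t` among `J` candidates so that the slab `{t − w ≤ ρ < t + w}` carries at most `‖f‖²/J` of the mass of `f`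
(pigeonhole); split `f = f₁ + f₂` along `t`; the diagonal terms are bounded by the WEIGHTED SCHUR TEST (`Literature.…SchurTestKernel`,
weights `e^{−τBS}` and `1`), the cross terms between the slab halves by the unweighted Schur test (row sums `linkCE`), and all other cross
terms by the Gaussian decay of the kinetic factor across a radial gap `w`: `E_B(U,V) ≤ e^{6B − B(ρ(U)−ρ(V))²}` (`linkE_le_exp_gap`).
No positivity of the transfer form is used (the split is an exact bilinear expansion), so no constant is lost.

## WHAT THIS IS NOT
The per-shell bounds are hypotheses here (modules `…ValleyFar`, `…ValleyNear`); NOT the crux, NOT THE CLAY GAP.  Sorry-free; no new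
definition, no named fact.
-/

set_option autoImplicit false

noncomputable section

open MeasureTheory Filter Topology Real
open scoped Matrix Quaternion RealInnerProductSpace
open Literature.MathematicalPhysics.QuantumFieldTheory
open Literature.MathematicalPhysics.QuantumLattice
open Literature.Analysis.OperatorTheory.YMMatrixModel
open Literature.Analysis.OperatorTheory.SchurTest

namespace Summit.QuantumFields.YangMills.Theorems.FemtoTransferGap

section Assembly

variable {B : ℝ}

set_option maxHeartbeats 400000 in
/-- **The two-shell assembly.**  Let `B > 0`, `w > 0`, `ρ₀ + w ≤ T`, `J ≥ 1` candidate slabs fitting in the window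
(`T + 2Jw ≤ 2T`), `Λ ≥ 0`, and a weight exponent `τ(t)` for every boundary `t`.  If for every `t ∈ [T, 2T]` the supersolution bounds
`J_{τ(t)} ≤ Λ` hold on the lower shell `ρ₀ ≤ ρ < t` and `J_0 ≤ Λ` on the upper shell `ρ ≥ t`, then every bounded measurable `f` vanishing on
`{ρ < ρ₀}` satisfies `⟨f, K_B f⟩ ≤ (Λ + linkCE B/J + 2e^{6B − Bw²}) ‖f‖²`. [cite: Grafakos2009, App. A.2] [cite: Helffer2013, Lemma 7.1] -/
theorem qform_le_of_twoShell (hB : 0 < B) {ρ₀ T w Λ : ℝ} (hw : 0 < w) (hρ₀w : ρ₀ + w ≤ T)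
    {J : ℕ} (hJ : 0 < J) (hJw : T + 2 * J * w ≤ 2 * T) (hΛ : 0 ≤ Λ) (τ : ℝ → ℝ)
    (h1 : ∀ t, T ≤ t → t ≤ 2 * T → ∀ U : Cfg, ρ₀ ≤ ‖zmCoord 1 U‖ → ‖zmCoord 1 U‖ < t →
      Real.exp ((τ t - 1 / 2) * B * wilsonAction su2Rep U) *
        ∫ V, linkE B U V * Real.exp (-(1 / 2 + τ t) * B * wilsonAction su2Rep V) ∂(configMeasure SU2 1) ≤ Λ)
    (h2 : ∀ t, T ≤ t → t ≤ 2 * T → ∀ U : Cfg, t ≤ ‖zmCoord 1 U‖ →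
      Real.exp ((0 - 1 / 2) * B * wilsonAction su2Rep U) *
        ∫ V, linkE B U V * Real.exp (-(1 / 2 + 0) * B * wilsonAction su2Rep V) ∂(configMeasure SU2 1) ≤ Λ)
    {f : Cfg → ℝ} (hfm : Measurable f) (hfb : ∃ C : ℝ, ∀ U, |f U| ≤ C) (hf0 : ∀ U, ‖zmCoord 1 U‖ < ρ₀ → f U = 0) :
    qform su2Rep B f f ≤ (Λ + linkCE B / J + 2 * Real.exp (6 * B - B * w ^ 2)) * l2 f f := by
  have hρm : Measurable fun U : Cfg => ‖zmCoord 1 U‖ := continuous_valleyRadius.measurable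
  have hl2 : l2 f f = ∫ U, f U ^ 2 ∂(configMeasure SU2 1) := by unfold l2; congr 1; funext U; ring
  obtain ⟨Cf, hCf⟩ := hfb
  have hf2int : ∀ (A : Set Cfg), MeasurableSet A → Integrable (fun U => A.indicator f U ^ 2) (configMeasure SU2 1) :=
    fun A hA => integrable_configMeasure_of_bounded ((hfm.indicator hA).pow_const 2)
      ⟨Cf ^ 2, fun U => by rw [abs_pow]; exact pow_le_pow_left₀ (abs_nonneg _) (abs_indicator_le hCf U) 2⟩
  -- §a. the pigeonholed slab
  obtain ⟨j, hjJ', hj⟩ := exists_light_slab (T := T) hw hJ hfm ⟨Cf, hCf⟩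
  have hjlt : (j : ℝ) + 1 ≤ J := by exact_mod_cast hjJ'
  -- §b. the boundary and the pieces
  set t : ℝ := T + (2 * j + 1) * w with ht
  have htT : T ≤ t := by rw [ht]; nlinarith [hw.le, (Nat.cast_nonneg j : (0:ℝ) ≤ j)]
  have ht2T : t ≤ 2 * T := by rw [ht]; nlinarith
  have htw : ρ₀ ≤ t - w := by rw [ht]; nlinarith [hw.le, (Nat.cast_nonneg j : (0:ℝ) ≤ j)]
  set A₁ : Set Cfg := {U | ρ₀ ≤ ‖zmCoord 1 U‖ ∧ ‖zmCoord 1 U‖ < t - w} with hA₁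
  set A₂ : Set Cfg := {U | t - w ≤ ‖zmCoord 1 U‖ ∧ ‖zmCoord 1 U‖ < t} with hA₂
  set B₁ : Set Cfg := {U | t ≤ ‖zmCoord 1 U‖ ∧ ‖zmCoord 1 U‖ < t + w} with hB₁
  set B₂ : Set Cfg := {U | t + w ≤ ‖zmCoord 1 U‖} with hB₂
  set S₁ : Set Cfg := {U | ρ₀ ≤ ‖zmCoord 1 U‖ ∧ ‖zmCoord 1 U‖ < t} with hS₁
  set S₂ : Set Cfg := {U | t ≤ ‖zmCoord 1 U‖} with hS₂
  have hA₁m : MeasurableSet A₁ := (measurableSet_radial _ _).1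
  have hA₂m : MeasurableSet A₂ := (measurableSet_radial _ _).1
  have hB₁m : MeasurableSet B₁ := (measurableSet_radial _ _).1
  have hB₂m : MeasurableSet B₂ := (measurableSet_radial (t + w) 0).2
  have hS₁m : MeasurableSet S₁ := (measurableSet_radial _ _).1
  have hS₂m : MeasurableSet S₂ := (measurableSet_radial t 0).2
  obtain ⟨ha₁m, ha₁b⟩ := piece_props hA₁m hfm ⟨Cf, hCf⟩
  obtain ⟨ha₂m, ha₂b⟩ := piece_props hA₂m hfm ⟨Cf, hCf⟩
  obtain ⟨hb₁m, hb₁b⟩ := piece_props hB₁m hfm ⟨Cf, hCf⟩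
  obtain ⟨hb₂m, hb₂b⟩ := piece_props hB₂m hfm ⟨Cf, hCf⟩
  obtain ⟨hf₁m, hf₁b⟩ := piece_props hS₁m hfm ⟨Cf, hCf⟩
  obtain ⟨hf₂m, hf₂b⟩ := piece_props hS₂m hfm ⟨Cf, hCf⟩
  -- pointwise decompositions
  have hdecS : ∀ U, f U = S₁.indicator f U + S₂.indicator f U := by
    intro U
    by_cases h0 : ‖zmCoord 1 U‖ < ρ₀
    · rw [hf0 U h0, Set.indicator_of_notMem, Set.indicator_of_notMem, add_zero]
      · simp only [hS₂, Set.mem_setOf_eq, not_le]; linarith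
      · simp only [hS₁, Set.mem_setOf_eq, not_and, not_lt]; intro h; linarith
    push Not at h0
    by_cases h1 : ‖zmCoord 1 U‖ < t
    · rw [Set.indicator_of_mem (show U ∈ S₁ from ⟨h0, h1⟩), Set.indicator_of_notMem, add_zero]
      simp only [hS₂, Set.mem_setOf_eq, not_le]; exact h1
    · push Not at h1
      rw [Set.indicator_of_notMem, Set.indicator_of_mem (show U ∈ S₂ from h1), zero_add]
      simp only [hS₁, Set.mem_setOf_eq, not_and, not_lt]; intro; exact h1
  have hdec1 : ∀ U, S₁.indicator f U = A₁.indicator f U + A₂.indicator f U := by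
    intro U
    by_cases hU : U ∈ S₁
    · rw [Set.indicator_of_mem hU]
      by_cases h1 : ‖zmCoord 1 U‖ < t - w
      · rw [Set.indicator_of_mem (show U ∈ A₁ from ⟨hU.1, h1⟩), Set.indicator_of_notMem, add_zero]
        simp only [hA₂, Set.mem_setOf_eq, not_and, not_lt]; intro h; linarith
      · push Not at h1
        rw [Set.indicator_of_notMem, Set.indicator_of_mem (show U ∈ A₂ from ⟨h1, hU.2⟩), zero_add]
        simp only [hA₁, Set.mem_setOf_eq, not_and, not_lt]; intro; exact h1
    · rw [Set.indicator_of_notMem hU, Set.indicator_of_notMem, Set.indicator_of_notMem, add_zero]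
      · simp only [hA₂, Set.mem_setOf_eq, not_and, not_lt]; intro h
        by_contra h'; push Not at h'; exact hU ⟨htw.trans h, h'⟩
      · simp only [hA₁, Set.mem_setOf_eq, not_and, not_lt]; intro h
        by_contra h'; push Not at h'; exact hU ⟨h, by linarith⟩
  have hdec2 : ∀ U, S₂.indicator f U = B₁.indicator f U + B₂.indicator f U := by
    intro U
    by_cases hU : U ∈ S₂
    · rw [Set.indicator_of_mem hU]
      by_cases h1 : ‖zmCoord 1 U‖ < t + w
      · rw [Set.indicator_of_mem (show U ∈ B₁ from ⟨hU, h1⟩), Set.indicator_of_notMem, add_zero]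
        simp only [hB₂, Set.mem_setOf_eq, not_le]; exact h1
      · push Not at h1
        rw [Set.indicator_of_notMem, Set.indicator_of_mem (show U ∈ B₂ from h1), zero_add]
        simp only [hB₁, Set.mem_setOf_eq, not_and, not_lt]; intro; exact h1
    · have hU' : ‖zmCoord 1 U‖ < t := by simpa [hS₂] using hU
      rw [Set.indicator_of_notMem hU, Set.indicator_of_notMem, Set.indicator_of_notMem, add_zero]
      · simp only [hB₂, Set.mem_setOf_eq, not_le]; linarith
      · simp only [hB₁, Set.mem_setOf_eq, not_and, not_lt]; intro h; linarith
  -- disjointness products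
  have hS12 : ∀ U, S₁.indicator f U * S₂.indicator f U = 0 := by
    intro U
    by_cases hU : U ∈ S₁
    · rw [Set.indicator_of_notMem (show U ∉ S₂ by simp only [hS₂, Set.mem_setOf_eq, not_le]; exact hU.2), mul_zero]
    · rw [Set.indicator_of_notMem hU, zero_mul]
  have hA12 : ∀ U, A₁.indicator f U * A₂.indicator f U = 0 := by
    intro U
    by_cases hU : U ∈ A₁
    · rw [Set.indicator_of_notMem (show U ∉ A₂ by
        simp only [hA₂, Set.mem_setOf_eq, not_and, not_lt]; intro h; linarith [hU.2]), mul_zero]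
    · rw [Set.indicator_of_notMem hU, zero_mul]
  have hB12 : ∀ U, B₁.indicator f U * B₂.indicator f U = 0 := by
    intro U
    by_cases hU : U ∈ B₁
    · rw [Set.indicator_of_notMem (show U ∉ B₂ by simp only [hB₂, Set.mem_setOf_eq, not_le]; exact hU.2), mul_zero]
    · rw [Set.indicator_of_notMem hU, zero_mul]
  have hsqS : ∀ U, S₁.indicator f U ^ 2 + S₂.indicator f U ^ 2 = f U ^ 2 := fun U => by
    have h := hdecS U; have h' := hS12 U
    rw [h]; nlinarith [h']
  have hsq1 : ∀ U, A₁.indicator f U ^ 2 + A₂.indicator f U ^ 2 = S₁.indicator f U ^ 2 := fun U => by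
    have h := hdec1 U; have h' := hA12 U
    rw [h]; nlinarith [h']
  have hsq2 : ∀ U, B₁.indicator f U ^ 2 + B₂.indicator f U ^ 2 = S₂.indicator f U ^ 2 := fun U => by
    have h := hdec2 U; have h' := hB12 U
    rw [h]; nlinarith [h']
  -- the middle slab is `N j`
  have hslab : ∀ U, A₂.indicator f U ^ 2 + B₁.indicator f U ^ 2 = {U : Cfg | T + 2 * j * w ≤ ‖zmCoord 1 U‖ ∧ ‖zmCoord 1 U‖ < T + (2 * j + 2) * w}.indicator f U ^ 2 := by
    intro U
    have htm : t - w = T + 2 * j * w := by rw [ht]; ring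
    have htp : t + w = T + (2 * j + 2) * w := by rw [ht]; ring
    by_cases hU : U ∈ A₂
    · have hU' : U ∈ {U : Cfg | T + 2 * j * w ≤ ‖zmCoord 1 U‖ ∧ ‖zmCoord 1 U‖ < T + (2 * j + 2) * w} := by
        simp only [Set.mem_setOf_eq]; simp only [hA₂, Set.mem_setOf_eq] at hU
        constructor <;> linarith [hU.1, hU.2]
      rw [Set.indicator_of_mem hU, Set.indicator_of_mem hU', Set.indicator_of_notMem (show U ∉ B₁ by
        simp only [hB₁, Set.mem_setOf_eq, not_and, not_lt]; intro h; linarith [hU.2])]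
      ring
    · by_cases hV : U ∈ B₁
      · have hU' : U ∈ {U : Cfg | T + 2 * j * w ≤ ‖zmCoord 1 U‖ ∧ ‖zmCoord 1 U‖ < T + (2 * j + 2) * w} := by
          simp only [Set.mem_setOf_eq]; simp only [hB₁, Set.mem_setOf_eq] at hV
          constructor <;> linarith [hV.1, hV.2]
        rw [Set.indicator_of_notMem hU, Set.indicator_of_mem hV, Set.indicator_of_mem hU']
        ring
      · have hU' : U ∉ {U : Cfg | T + 2 * j * w ≤ ‖zmCoord 1 U‖ ∧ ‖zmCoord 1 U‖ < T + (2 * j + 2) * w} := by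
          intro hmem
          simp only [Set.mem_setOf_eq] at hmem
          by_cases hlt : ‖zmCoord 1 U‖ < t
          · exact hU ⟨by linarith [hmem.1], hlt⟩
          · push Not at hlt; exact hV ⟨hlt, by linarith [hmem.2]⟩
        rw [Set.indicator_of_notMem hU, Set.indicator_of_notMem hV, Set.indicator_of_notMem hU']
        ring
  -- integrals of squares
  have hIf := integrable_configMeasure_of_bounded (hfm.pow_const 2)
    ⟨Cf ^ 2, fun U => by rw [abs_pow]; exact pow_le_pow_left₀ (abs_nonneg _) (hCf U) 2⟩
  have eS : (∫ U, S₁.indicator f U ^ 2 ∂(configMeasure SU2 1)) + ∫ U, S₂.indicator f U ^ 2 ∂(configMeasure SU2 1)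
      = ∫ U, f U ^ 2 ∂(configMeasure SU2 1) := by
    rw [← integral_add (hf2int _ hS₁m) (hf2int _ hS₂m)]
    exact integral_congr_ae (ae_of_all _ hsqS)
  have e1 : (∫ U, A₁.indicator f U ^ 2 ∂(configMeasure SU2 1)) + ∫ U, A₂.indicator f U ^ 2 ∂(configMeasure SU2 1)
      = ∫ U, S₁.indicator f U ^ 2 ∂(configMeasure SU2 1) := by
    rw [← integral_add (hf2int _ hA₁m) (hf2int _ hA₂m)]
    exact integral_congr_ae (ae_of_all _ hsq1)
  have e2 : (∫ U, B₁.indicator f U ^ 2 ∂(configMeasure SU2 1)) + ∫ U, B₂.indicator f U ^ 2 ∂(configMeasure SU2 1)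
      = ∫ U, S₂.indicator f U ^ 2 ∂(configMeasure SU2 1) := by
    rw [← integral_add (hf2int _ hB₁m) (hf2int _ hB₂m)]
    exact integral_congr_ae (ae_of_all _ hsq2)
  have eN : (∫ U, A₂.indicator f U ^ 2 ∂(configMeasure SU2 1)) + ∫ U, B₁.indicator f U ^ 2 ∂(configMeasure SU2 1)
      = ∫ U, {U : Cfg | T + 2 * j * w ≤ ‖zmCoord 1 U‖ ∧ ‖zmCoord 1 U‖ < T + (2 * j + 2) * w}.indicator f U ^ 2
        ∂(configMeasure SU2 1) := by
    rw [← integral_add (hf2int _ hA₂m) (hf2int _ hB₁m)]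
    exact integral_congr_ae (ae_of_all _ hslab)
  have hi0 : ∀ (A : Set Cfg), 0 ≤ ∫ U, A.indicator f U ^ 2 ∂(configMeasure SU2 1) := fun A => integral_nonneg fun U => sq_nonneg _
  -- the gap bound on the kernel
  set ε : ℝ := Real.exp (6 * B - B * w ^ 2) with hε
  have hε0 : 0 ≤ ε := (Real.exp_pos _).le
  have hgap : ∀ U V : Cfg, w ≤ |‖zmCoord 1 U‖ - ‖zmCoord 1 V‖| → transferKernel su2Rep B U V ≤ ε := by
    intro U V hUV
    refine (transferKernel_le_exp_gap hB.le U V).trans (Real.exp_le_exp.2 ?_)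
    have : w ^ 2 ≤ (‖zmCoord 1 U‖ - ‖zmCoord 1 V‖) ^ 2 := by
      rw [← sq_abs (‖zmCoord 1 U‖ - _)]; exact pow_le_pow_left₀ hw.le hUV 2
    nlinarith
  have memA₁ : ∀ U, A₁.indicator f U ≠ 0 → ‖zmCoord 1 U‖ < t - w := fun U h => (Set.mem_of_indicator_ne_zero h).2
  have memA₂ : ∀ U, A₂.indicator f U ≠ 0 → ‖zmCoord 1 U‖ < t := fun U h => (Set.mem_of_indicator_ne_zero h).2
  have memB₁ : ∀ U, B₁.indicator f U ≠ 0 → t ≤ ‖zmCoord 1 U‖ := fun U h => (Set.mem_of_indicator_ne_zero h).1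
  have memB₂ : ∀ U, B₂.indicator f U ≠ 0 → t + w ≤ ‖zmCoord 1 U‖ := fun U h => by
    have hm : U ∈ B₂ := Set.mem_of_indicator_ne_zero h
    simpa only [hB₂, Set.mem_setOf_eq] using hm
  -- §c. expansion of the form
  rw [qform_eq_prodIntegral hB.le hfm ⟨Cf, hCf⟩]
  rw [integral_congr_ae (ae_of_all _ fun p : Cfg × Cfg =>
    show f p.1 * transferKernel su2Rep B p.1 p.2 * f p.2
      = (S₁.indicator f p.1 + S₂.indicator f p.1) * transferKernel su2Rep B p.1 p.2 * (S₁.indicator f p.2 + S₂.indicator f p.2) by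
      rw [← hdecS, ← hdecS])]
  rw [prodIntegral_add_left hB.le (b := fun V => S₁.indicator f V + S₂.indicator f V) hf₁m hf₂m (hf₁m.add hf₂m) hf₁b hf₂b (by
        obtain ⟨C1, hC1⟩ := hf₁b; obtain ⟨C2, hC2⟩ := hf₂b
        exact ⟨C1 + C2, fun U => (abs_add_le _ _).trans (add_le_add (hC1 U) (hC2 U))⟩),
    prodIntegral_add_right hB.le hf₁m hf₁m hf₂m hf₁b hf₁b hf₂b,
    prodIntegral_add_right hB.le hf₂m hf₁m hf₂m hf₂b hf₁b hf₂b]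
  -- diagonal terms
  have d1 := prodIntegral_le_weighted hB hΛ hS₁m hf₁m hf₁b (fun U hU => Set.indicator_of_notMem hU f)
    (τ := τ t) (fun U hU => h1 t htT ht2T U hU.1 hU.2)
  have d2 := prodIntegral_le_weighted hB hΛ hS₂m hf₂m hf₂b (fun U hU => Set.indicator_of_notMem hU f)
    (τ := 0) (fun U hU => h2 t htT ht2T U hU)
  -- cross terms
  have sepA₁B₁ : ∀ U V, A₁.indicator f U ≠ 0 → B₁.indicator f V ≠ 0 → transferKernel su2Rep B U V ≤ ε := fun U V hU hV =>
    hgap U V (by rw [abs_sub_comm, abs_of_nonneg (by linarith [memA₁ U hU, memB₁ V hV])]; linarith [memA₁ U hU, memB₁ V hV])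
  have sepA₁B₂ : ∀ U V, A₁.indicator f U ≠ 0 → B₂.indicator f V ≠ 0 → transferKernel su2Rep B U V ≤ ε := fun U V hU hV =>
    hgap U V (by rw [abs_sub_comm, abs_of_nonneg (by linarith [memA₁ U hU, memB₂ V hV])]; linarith [memA₁ U hU, memB₂ V hV])
  have sepA₂B₂ : ∀ U V, A₂.indicator f U ≠ 0 → B₂.indicator f V ≠ 0 → transferKernel su2Rep B U V ≤ ε := fun U V hU hV =>
    hgap U V (by rw [abs_sub_comm, abs_of_nonneg (by linarith [memA₂ U hU, memB₂ V hV])]; linarith [memA₂ U hU, memB₂ V hV])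
  have sepB₁A₁ : ∀ U V, B₁.indicator f U ≠ 0 → A₁.indicator f V ≠ 0 → transferKernel su2Rep B U V ≤ ε := fun U V hU hV =>
    hgap U V (by rw [abs_of_nonneg (by linarith [memB₁ U hU, memA₁ V hV])]; linarith [memB₁ U hU, memA₁ V hV])
  have sepB₂A₁ : ∀ U V, B₂.indicator f U ≠ 0 → A₁.indicator f V ≠ 0 → transferKernel su2Rep B U V ≤ ε := fun U V hU hV =>
    hgap U V (by rw [abs_of_nonneg (by linarith [memB₂ U hU, memA₁ V hV])]; linarith [memB₂ U hU, memA₁ V hV])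
  have sepB₂A₂ : ∀ U V, B₂.indicator f U ≠ 0 → A₂.indicator f V ≠ 0 → transferKernel su2Rep B U V ≤ ε := fun U V hU hV =>
    hgap U V (by rw [abs_of_nonneg (by linarith [memB₂ U hU, memA₂ V hV])]; linarith [memB₂ U hU, memA₂ V hV])
  have c12 := cross_bound hB hfm ⟨Cf, hCf⟩ hS₁m hS₂m hA₁m hA₂m hB₁m hB₂m hdec1 hdec2 hε0 sepA₁B₁ sepA₁B₂ sepA₂B₂
  -- for the reversed order use `1_{S₂} f = 1_{B₂} f + 1_{B₁} f`, `1_{S₁} f = 1_{A₂} f + 1_{A₁} f`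
  have c21 := cross_bound hB hfm ⟨Cf, hCf⟩ hS₂m hS₁m hB₂m hB₁m hA₂m hA₁m (fun U => by rw [hdec2 U, add_comm])
    (fun U => by rw [hdec1 U, add_comm]) hε0 sepB₂A₂ sepB₂A₁ sepB₁A₁
  -- §d. collect
  clear_value ε A₁ A₂ B₁ B₂ S₁ S₂ t
  have hJ0 : (0 : ℝ) < J := by exact_mod_cast hJ
  have hCE : 0 ≤ linkCE B := (linkCE_pos hB.le).le
  rw [hl2]
  have key : linkCE B / 2 * ((∫ U, A₂.indicator f U ^ 2 ∂(configMeasure SU2 1)) + ∫ U, B₁.indicator f U ^ 2 ∂(configMeasure SU2 1))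
      + linkCE B / 2 * ((∫ U, B₁.indicator f U ^ 2 ∂(configMeasure SU2 1)) + ∫ U, A₂.indicator f U ^ 2 ∂(configMeasure SU2 1))
      ≤ linkCE B / J * ∫ U, f U ^ 2 ∂(configMeasure SU2 1) := by
    rw [add_comm (∫ U, B₁.indicator f U ^ 2 ∂(configMeasure SU2 1)), eN]
    have : linkCE B * ∫ U, {U : Cfg | T + 2 * j * w ≤ ‖zmCoord 1 U‖ ∧ ‖zmCoord 1 U‖ < T + (2 * j + 2) * w}.indicator f U ^ 2
        ∂(configMeasure SU2 1) ≤ linkCE B * ((∫ U, f U ^ 2 ∂(configMeasure SU2 1)) / J) :=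
      mul_le_mul_of_nonneg_left hj hCE
    have e : linkCE B * ((∫ U, f U ^ 2 ∂(configMeasure SU2 1)) / J) = linkCE B / J * ∫ U, f U ^ 2 ∂(configMeasure SU2 1) := by
      field_simp
    linarith only [this, e]
  -- collect (all linear in the square integrals)
  have htot : (∫ U, A₁.indicator f U ^ 2 ∂(configMeasure SU2 1)) + (∫ U, A₂.indicator f U ^ 2 ∂(configMeasure SU2 1)) + (∫ U, B₁.indicator f U ^ 2 ∂(configMeasure SU2 1)) + (∫ U, B₂.indicator f U ^ 2 ∂(configMeasure SU2 1)) = (∫ U, f U ^ 2 ∂(configMeasure SU2 1)) := by linarith only [e1, e2, eS]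
  have hΛsum : Λ * (∫ U, S₁.indicator f U ^ 2 ∂(configMeasure SU2 1)) + Λ * (∫ U, S₂.indicator f U ^ 2 ∂(configMeasure SU2 1)) = Λ * (∫ U, f U ^ 2 ∂(configMeasure SU2 1)) := by rw [← mul_add, eS]
  have hεsum : ε / 2 * ((∫ U, A₁.indicator f U ^ 2 ∂(configMeasure SU2 1)) + (∫ U, B₁.indicator f U ^ 2 ∂(configMeasure SU2 1))) + ε / 2 * ((∫ U, A₁.indicator f U ^ 2 ∂(configMeasure SU2 1)) + (∫ U, B₂.indicator f U ^ 2 ∂(configMeasure SU2 1))) + ε / 2 * ((∫ U, A₂.indicator f U ^ 2 ∂(configMeasure SU2 1)) + (∫ U, B₂.indicator f U ^ 2 ∂(configMeasure SU2 1)))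
      + (ε / 2 * ((∫ U, B₂.indicator f U ^ 2 ∂(configMeasure SU2 1)) + (∫ U, A₂.indicator f U ^ 2 ∂(configMeasure SU2 1))) + ε / 2 * ((∫ U, B₂.indicator f U ^ 2 ∂(configMeasure SU2 1)) + (∫ U, A₁.indicator f U ^ 2 ∂(configMeasure SU2 1))) + ε / 2 * ((∫ U, B₁.indicator f U ^ 2 ∂(configMeasure SU2 1)) + (∫ U, A₁.indicator f U ^ 2 ∂(configMeasure SU2 1)))) ≤ 2 * ε * (∫ U, f U ^ 2 ∂(configMeasure SU2 1)) := by
    have h4 : 4 * (∫ U, A₁.indicator f U ^ 2 ∂(configMeasure SU2 1)) + 2 * (∫ U, A₂.indicator f U ^ 2 ∂(configMeasure SU2 1)) + 2 * (∫ U, B₁.indicator f U ^ 2 ∂(configMeasure SU2 1)) + 4 * (∫ U, B₂.indicator f U ^ 2 ∂(configMeasure SU2 1)) ≤ 4 * (∫ U, f U ^ 2 ∂(configMeasure SU2 1)) := by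
      linarith only [htot, hi0 A₁, hi0 A₂, hi0 B₁, hi0 B₂]
    have := mul_le_mul_of_nonneg_left h4 hε0
    linarith only [this]
  have e : (Λ + linkCE B / J + 2 * ε) * (∫ U, f U ^ 2 ∂(configMeasure SU2 1)) = Λ * (∫ U, f U ^ 2 ∂(configMeasure SU2 1)) + linkCE B / J * (∫ U, f U ^ 2 ∂(configMeasure SU2 1)) + 2 * ε * (∫ U, f U ^ 2 ∂(configMeasure SU2 1)) := by ring
  rw [e]
  linarith only [d1, d2, c12, c21, key, hΛsum, hεsum]

end Assembly

end Summit.QuantumFields.YangMills.Theorems.FemtoTransferGap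

end
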